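import Summits.ResolutionOfSingularities.ResolutionOfSingularities.Theorems.MaxContactCutStallVertexFlat
import Summits.ResolutionOfSingularities.ResolutionOfSingularities.Theorems.CoefficientCutLaws
import Summits.ResolutionOfSingularities.ResolutionOfSingularities.Theorems.MaxContactCutCoefficientCut
import Literature.AlgebraicGeometry.Resolution.PointBlowupDirectrixBaseChange
import Mathlib.FieldTheory.IsAlgClosed.AlgebraicClosure
import Literature.RingTheory.MvPolynomial.RuppertMatrix
import HarnessLib

/-!
# PlanarPortFunctor — decomp-res node «PlanarPort» (lens-5 g24, critic row 165), tree file 1/3 of the node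

Content VERBATIM from the decomp-res lens-5 g24 node `HOME/decomp-res-lens-5/g24/PlanarPort.lean` rev 0 (pin
814caf7a = `parts/PlanarPort-g24-rev0-814caf7a.lean`, 895 l;
HOME = run/shared/lean/pub/decomp-res; node memo `g24/NODE.md` a59ec294 = `parts/NODE-g24-rev0-a59ec294.md`: node
equation, tags, probes), typed against the LANDED
tree (imports `Theorems/MaxContactCutStallVertexFlat` + `CoefficientCutLaws` + `MaxContactCutCoefficientCut` +
Literature `PointBlowupDirectrixBaseChange` + Mathlib
`IsAlgClosed.AlgebraicClosure`).  Critic: CRITIC-LEDGER row 165 (2026-08-31T01:58:53Z): CLEARED — MAP +1 · DECIDED 0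
(the PLANAR PORT: the plane-section functor
carries the monomial planar case to the two-letter purely-inseparable surface model of [HauserPerlega2024]; H-P half
of the port class CLOSED modulo the named
propositions Prop. 3 + Prop. 4; EXACT hypothesis-free split of 28121; KERNEL LAW `layer_zero_not_monomialLed`).
Landing orders INBOX :677 (critic riders row 165;
slices `g24/parts/PlanarPortFunctor.lean` 51c06d10 = §1–§4 and `PlanarPortClasses.lean` e6aa67c7 = §5,
sha-verified): `--kind proof --supports
stmt-ResolutionOfSingularities-31770` (`MaxContactCut.DefectWalksDeep`), namespace `…Theorems.PlanarPort` (the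
lens's), canonical headers; nothing closes 31770.
The node is IN THE Theses CONE (its tree imports reach `Theses.MaxContactCut` through `PlanarCutStates →
MaxContactCutExitLaw`), so — as for the in-cone
«StallVertex» nodes (rev 48) — the located residual `NoTerminalSectionPlanarJointTailsDeep` is recorded on the route
by RE-INFORMALISING 28121 (attack surface
SUPERSEDED by this leaf; 28121 itself stays filed unchanged as the port item, now split exactly) and in
HOME/TREE.md, not as an importable aside declaration
(the route file cannot import an in-cone module).  Required companion (row 165 (3)): the Literature home of
`MaximizingFlagExistsStatement`, proposal p802948.

The lens header, verbatim:

> # PlanarPort — the plane-section functor of the monomial planar case and its Hauser–Perlega half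
> # (lens-5 «decomp-res», g24; node `…Theorems.PlanarPort`, host route MaxContactCut, target 31770 BY NAME)
>
> MODULE DOCSTRING: see `g24/NODE.md` (node equation, tags, probes).  Summary of the declarations:
>
> * §1  the SECTION FUNCTOR `res i j k : K[u_i,u_j,u_k] → K[X₀,X₁]` (`u_i ↦ X₀, u_j ↦ X₁, u_k ↦ 0`) on exponents
>   (`secExp`, `liftExp`) and polynomials, with its transport laws: coefficients (`coeff_res`), the two-letter planar
>   coefficient formula (`coeff_pointTransform_two`), `res ∘ (planar point transform) = (point transform) ∘ res`
>   (`res_pointTransform`, both plane charts), cleaning (`res_deletePthPowers`), equimultiplicity (`isEquimultiplePoint_res`),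
>   order (`le_ordZero_res`), non-vanishing on a nonempty wall layer `0` (`res_ne_zero_of_layer_zero`).
> * §2  BASE CHANGE to `K̄ = AlgebraicClosure K` and the SECTION STATE `secState i j k s : State (Fin 2) K̄`
>   (`F ↦ (res F) ⊗ 1`, `r ↦ (r_i, r_j)`); one planar `step` of the three-letter model is carried to one `step` of the
>   two-letter model: same `F` (`secState_step_F`) and same exceptional letters (`excLetters_secState_step`).
> * §3  Hauser–Perlega 2024 as NAMED PROPOSITIONS over an algebraically closed field: the tree's
>   `HauserPerlega2024.FlagInvariantDropsStatement` (Prop. 4 p. 793) and the existence clause of Prop. 3 p. 791 typed here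
>   (`MaximizingFlagExistsStatement`); well-founded descent on `Triple = ℕ ×ₗ ℕ ×ₗ ℕ∞`.
> * §4  THE KERNEL LAW «layer 0 is never monomial-led» on a tail of the monomial planar case
(`not_monomialLed_zero_of_translated`,
>   `monomialLed_zero_step_of_untranslated`, walk form `layer_zero_not_monomialLed`).
> * §5  CLASSES: the H-P-decided piece `NoNonTerminalSectionPlanarJointTailsDeep` (DERIVED from §3: `nonTerminalSection_of_HP`),
>   the located residual `NoTerminalSectionPlanarJointTailsDeep`, the EXACT split of the port class
>   `CoefficientCut.NoMonomialLedPlanarJointTailsDeep`, and `closes_planarPort … : MaxContactCut.DefectWalksDeep` BY NAME.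

## This file

§1–§4 of the node = the critic's slice `g24/parts/PlanarPortFunctor.lean` (51c06d10, 715 l), cut at the 400-line cap
into `PlanarPortFunctor` · `PlanarPortFunctor2` (· `…3`): §1 the SECTION FUNCTOR `res i j k : K[u_i,u_j,u_k] →
K[X₀,X₁]` (`u_i ↦ X₀, u_j ↦ X₁, u_k ↦ 0`) on exponents (`secExp`, `liftExp`) and polynomials with its transport laws
(`coeff_res`, the two-letter planar coefficient formula `coeff_pointTransform_two`, `res_pointTransform` in both
plane charts, cleaning `res_deletePthPowers`, equimultiplicity `isEquimultiplePoint_res`, order `le_ordZero_res`,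
non-vanishing on a nonempty wall layer `0` `res_ne_zero_of_layer_zero`); §2 BASE CHANGE to `K̄ = AlgebraicClosure K`
and the SECTION STATE `secState i j k s : State (Fin 2) K̄` (`secState_step_F`, `excLetters_secState_step`); §3
[HP24] as NAMED PROPOSITIONS over an algebraically closed field — the existence clause of Prop. 3 p. 791 typed here
as `MaximizingFlagExistsStatement` (NOT asserted; its Literature home `Literature/…/PointBlowupFlagInvariant` is
proposed in parallel, p802948, review-queued — this Theorems copy is meant to become an `abbrev` of it), `HP24Prop3`
/ `HP24Prop4` (the tree's `HauserPerlega2024.FlagInvariantDropsStatement`, Prop. 4 p. 793), well-founded descent on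
`Triple`; §4 THE KERNEL LAW «on a tail of the monomial planar case the wall layer `0` is never monomial-led»
(`sm_comm`, `not_monomialLed_zero_of_translated`, `monomialLed_zero_step_of_untranslated`, walk form
**`layer_zero_not_monomialLed`**, hypothesis-free).  (This first part carries: `prod_two`, `chartExponent_apply'`,
`coeff_pointTransform_two`, `secExp`, `liftExp`, `secExp_zero`, `secExp_one`, `secExp_apply`, `degree_secExp'`,
`liftExp_i`, `liftExp_j`, `liftExp_k`, `secExp_liftExp`, `liftExp_secExp`, `degree_liftExp`, `degree_secExp`,
`isPthPowerExponent_liftExp`, `res`, `coeff_res`, `mem_support_res`, `secExp_mem_support_res`,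
`le_degree_of_mem_support_res`, `sum_res_support`, `idx`, `secPt`, `res_pointTransform`, `res_deletePthPowers`,
`le_ordZero_res`, `res_ne_zero_of_layer_zero`, `isEquimultiplePoint_res`, `map_deletePthPowers`.)

[WRITER NOTE (decomp-res writer g10): file split only (tree files ≤ 400 lines); namespace, sections, section
variables and every declaration exactly as in
the lens (the lens's global dupNamespace-linter line is dropped — the library sets it).  DEDUP (gate `dedup.landed`,
p803047): the lens's two-line
helper `degree_two` restates the landed Literature theorem
`Literature.RingTheory.MvPolynomial.Ruppert.degree_fin_two` — the copy is dropped and its two use sites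
(`degree_secExp'`, `degree_liftExp`) cite the Literature theorem by its full name; import
`Literature/RingTheory/MvPolynomial/RuppertMatrix` added.]

(Sources: HauserPerlega2024 (Publ. RIMS 60; Prop. 3 p. 791, Prop. 4 p. 793, §3 p. 775, §7 p. 788); Perlega2017
(arXiv:2011.14443) §7.3; Hauser2010Kangaroo; BenitoVillamayor2012 §4; KawanoueMatsuki2016 §5; Moh1987; CossartPiltant2008 §2.)
-/

open MvPolynomial Finset
open Literature.AlgebraicGeometry.Resolution
open Literature.AlgebraicGeometry.Resolution.Hauser2010
open Literature.AlgebraicGeometry.Resolution.HauserPerlega2024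
open Literature.AlgebraicGeometry.Resolution.PointBlowup
open Literature.AlgebraicGeometry.Resolution.WeightedBlowup
open Summit.ResolutionOfSingularities.ResolutionOfSingularities.Theses
open Summit.ResolutionOfSingularities.ResolutionOfSingularities.Theorems.TightDefectClasses
open Summit.ResolutionOfSingularities.ResolutionOfSingularities.Theorems.TightDefectStrongWalks
open Summit.ResolutionOfSingularities.ResolutionOfSingularities.Theorems.ItineraryCutClasses
open Summit.ResolutionOfSingularities.ResolutionOfSingularities.Theorems.ProximityCut
open Summit.ResolutionOfSingularities.ResolutionOfSingularities.Theorems.ExitLaw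
open Summit.ResolutionOfSingularities.ResolutionOfSingularities.Theorems.PlanarCut
open Summit.ResolutionOfSingularities.ResolutionOfSingularities.Theorems.CoefficientCut

namespace Summit.ResolutionOfSingularities.ResolutionOfSingularities.Theorems.PlanarPort

section Section

variable {K : Type} [Field K]

/-! ## §1 The plane-section functor `u_k = 0` on exponents and polynomials -/

/-- Product over `Fin 2` in a chosen order. [folklore] -/
theorem prod_two {M : Type*} [CommMonoid M] {m n : Fin 2} (hmn : m ≠ n) (f : Fin 2 → M) : ∏ l, f l = f m * f n := by
  rw [Fin.prod_univ_two]
  fin_cases m <;> fin_cases n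
  · exact absurd rfl hmn
  · rfl
  · exact mul_comm _ _
  · exact absurd rfl hmn

/-- The chart exponent, evaluated (any index type). [folklore] -/
theorem chartExponent_apply' {σ : Type*} [DecidableEq σ] (q : ℕ) (j : σ) (d : σ →₀ ℕ) (l : σ) :
    chartExponent q j d l = if l = j then d.degree - q else d l := by
  unfold chartExponent
  rw [Finsupp.coe_update, Function.update_apply]

/-- **Two-letter planar coefficient formula (PROVED):** chart `X_n`, translation `X_m ↦ X_m + b_m` (`b_n = 0`), `G` of
order `≥ q`: `coeff_c G' = Σ_{|d| = c_n + q} coeff_d G · C(d_m, c_m) · b_m^{d_m − c_m}`. [folklore] -/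
theorem coeff_pointTransform_two {m n : Fin 2} (hmn : m ≠ n) (q : ℕ) (b : Fin 2 → K) (hbn : b n = 0)
    (G : MvPolynomial (Fin 2) K) (hG : ∀ d ∈ G.support, q ≤ d.degree) (c : Fin 2 →₀ ℕ) :
    coeff c (translate b (chartTransform q n G)) =
      ∑ d ∈ G.support with d.degree = c n + q, coeff d G * ((((d m).choose (c m) : ℕ) : K) * b m ^ (d m - c m)) := by
  classical
  unfold chartTransform
  rw [translate_finset_sum, coeff_sum, Finset.sum_filter]
  refine Finset.sum_congr rfl fun d hd => ?_
  rw [coeff_translate_monomial, prod_two hmn, chartExponent_apply', chartExponent_apply', if_neg hmn, if_pos rfl, hbn,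
    choose_mul_zero_pow]
  have hq := hG d hd
  by_cases h2 : d.degree = c n + q
  · rw [if_pos (by omega), if_pos h2, mul_one]
  · rw [if_neg (by omega), mul_zero, mul_zero, if_neg h2]

variable {i j k : Fin 3} (hij : i ≠ j) (hjk : j ≠ k) (hik : i ≠ k)

/-- The plane exponent `(d_i, d_j)` of `u^d`, on the letters `X₀, X₁`.  DEFINITION (support). -/
noncomputable def secExp (i j : Fin 3) (d : Fin 3 →₀ ℕ) : Fin 2 →₀ ℕ :=
  Finsupp.single 0 (d i) + Finsupp.single 1 (d j)

/-- The exponent `u_i^{c₀} u_j^{c₁}` of the plane `u_k = 0` lifting `X^c`.  DEFINITION (support). -/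
noncomputable def liftExp (i j k : Fin 3) (c : Fin 2 →₀ ℕ) : Fin 3 →₀ ℕ := exp3 i j k (c 0) (c 1) 0

omit hij hjk hik in
/-- [folklore] -/
theorem secExp_zero (d : Fin 3 →₀ ℕ) : secExp i j d 0 = d i := by
  simp [secExp]

omit hij hjk hik in
/-- [folklore] -/
theorem secExp_one (d : Fin 3 →₀ ℕ) : secExp i j d 1 = d j := by
  simp [secExp]

omit hij hjk hik in
/-- [folklore] -/
theorem secExp_apply (d : Fin 3 →₀ ℕ) (m : Fin 2) : secExp i j d m = if m = 0 then d i else d j := by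
  fin_cases m
  · exact secExp_zero d
  · exact secExp_one d

omit hij hjk hik in
/-- [folklore] -/
theorem degree_secExp' (d : Fin 3 →₀ ℕ) : (secExp i j d).degree = d i + d j := by
  rw [Literature.RingTheory.MvPolynomial.Ruppert.degree_fin_two, secExp_zero, secExp_one]

include hij hjk hik

omit hjk in
/-- [folklore] -/
theorem liftExp_i (c : Fin 2 →₀ ℕ) : liftExp i j k c i = c 0 := exp3_i hij hik _ _ _

omit hik in
/-- [folklore] -/
theorem liftExp_j (c : Fin 2 →₀ ℕ) : liftExp i j k c j = c 1 := exp3_j hij hjk _ _ _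

omit hij in
/-- [folklore] -/
theorem liftExp_k (c : Fin 2 →₀ ℕ) : liftExp i j k c k = 0 := exp3_k hjk hik _ _ _

/-- [folklore] -/
theorem secExp_liftExp (c : Fin 2 →₀ ℕ) : secExp i j (liftExp i j k c) = c := by
  ext m
  fin_cases m
  · exact (secExp_zero _).trans (liftExp_i hij hik c)
  · exact (secExp_one _).trans (liftExp_j hij hjk c)

/-- [folklore] -/
theorem liftExp_secExp {d : Fin 3 →₀ ℕ} (hd : d k = 0) : liftExp i j k (secExp i j d) = d :=
  finsupp_ext_three hij hjk hik (by rw [liftExp_i hij hik, secExp_zero]) (by rw [liftExp_j hij hjk, secExp_one])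
    (by rw [liftExp_k hjk hik, hd])

/-- [folklore] -/
theorem degree_liftExp (c : Fin 2 →₀ ℕ) : (liftExp i j k c).degree = c.degree := by
  rw [degree_three hij hjk hik, liftExp_i hij hik, liftExp_j hij hjk, liftExp_k hjk hik, Literature.RingTheory.MvPolynomial.Ruppert.degree_fin_two, add_zero]

/-- [folklore] -/
theorem degree_secExp {d : Fin 3 →₀ ℕ} (hd : d k = 0) : (secExp i j d).degree = d.degree := by
  rw [degree_secExp', degree_three hij hjk hik, hd, add_zero]

/-- `u^d` (`d_k = 0`) is a `q`-th power iff its plane exponent is. [folklore] -/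
theorem isPthPowerExponent_liftExp (q : ℕ) (c : Fin 2 →₀ ℕ) :
    IsPthPowerExponent q (liftExp i j k c) ↔ IsPthPowerExponent q c := by
  rw [isPthPowerExponent_iff, isPthPowerExponent_iff]
  constructor
  · intro h m
    fin_cases m
    · simpa [liftExp_i hij hik] using h i
    · simpa [liftExp_j hij hjk] using h j
  · intro h l
    rcases fin3_cases ⟨hij, hjk, hik⟩ l with rfl | rfl | rfl
    · rw [liftExp_i hij hik]; exact h 0
    · rw [liftExp_j hij hjk]; exact h 1
    · rw [liftExp_k hjk hik]; exact dvd_zero q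

omit hij hjk hik in
/-- **The plane section** `res F = F(u_i ↦ X₀, u_j ↦ X₁, u_k ↦ 0)`: the wall layer `0` of `F` read in two letters — the
restriction `G⁽⁰⁾|_{V'}` of the port dictionary (g19 PORT.md, object `V'_t = {Z = u_k = 0}`).  DEFINITION (support). -/
noncomputable def res (i j k : Fin 3) (F : MvPolynomial (Fin 3) K) : MvPolynomial (Fin 2) K :=
  ∑ d ∈ F.support with d k = 0, monomial (secExp i j d) (coeff d F)

/-- **Coefficients of the section (PROVED):** `coeff_c (res F) = coeff_{u_i^{c₀} u_j^{c₁}} F`. [folklore] -/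
theorem coeff_res (F : MvPolynomial (Fin 3) K) (c : Fin 2 →₀ ℕ) : coeff c (res i j k F) = coeff (liftExp i j k c) F := by
  classical
  unfold res
  rw [coeff_sum]
  simp only [coeff_monomial]
  rw [Finset.sum_eq_single (liftExp i j k c)]
  · rw [if_pos (secExp_liftExp hij hjk hik c)]
  · intro d hd hne
    rw [if_neg]
    intro h
    apply hne
    rw [← h, liftExp_secExp hij hjk hik (Finset.mem_filter.mp hd).2]
  · intro h
    rw [if_pos (secExp_liftExp hij hjk hik c)]
    by_contra hne
    exact h (Finset.mem_filter.mpr ⟨MvPolynomial.mem_support_iff.mpr hne, liftExp_k hjk hik c⟩)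

/-- Support of the section. [folklore] -/
theorem mem_support_res {F : MvPolynomial (Fin 3) K} {c : Fin 2 →₀ ℕ} :
    c ∈ (res i j k F).support ↔ liftExp i j k c ∈ F.support := by
  rw [MvPolynomial.mem_support_iff, MvPolynomial.mem_support_iff, coeff_res hij hjk hik]

/-- [folklore] -/
theorem secExp_mem_support_res {F : MvPolynomial (Fin 3) K} {d : Fin 3 →₀ ℕ} (hd : d ∈ F.support) (hk : d k = 0) :
    secExp i j d ∈ (res i j k F).support := by
  rw [mem_support_res hij hjk hik, liftExp_secExp hij hjk hik hk]
  exact hd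

/-- The section keeps the order bound. [folklore] -/
theorem le_degree_of_mem_support_res {q : ℕ} {F : MvPolynomial (Fin 3) K} (hF : ∀ d ∈ F.support, q ≤ d.degree)
    {c : Fin 2 →₀ ℕ} (hc : c ∈ (res i j k F).support) : q ≤ c.degree := by
  rw [← degree_liftExp hij hjk hik]
  exact hF _ ((mem_support_res hij hjk hik).mp hc)

/-- Re-indexing a sum over the support of the section by the plane exponents of `F`. [folklore] -/
theorem sum_res_support (F : MvPolynomial (Fin 3) K) (P : (Fin 2 →₀ ℕ) → Prop) [DecidablePred P]
    (g : (Fin 2 →₀ ℕ) → K) :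
    ∑ c ∈ (res i j k F).support with P c, coeff c (res i j k F) * g c =
      ∑ d ∈ F.support with (d k = 0 ∧ P (secExp i j d)), coeff d F * g (secExp i j d) := by
  refine Finset.sum_nbij' (liftExp i j k) (secExp i j) ?_ ?_ ?_ ?_ ?_
  · intro c hc
    rw [Finset.mem_filter] at hc ⊢
    exact ⟨(mem_support_res hij hjk hik).mp hc.1, liftExp_k hjk hik c, by rw [secExp_liftExp hij hjk hik]; exact hc.2⟩
  · intro d hd
    rw [Finset.mem_filter] at hd ⊢
    exact ⟨secExp_mem_support_res hij hjk hik hd.1 hd.2.1, hd.2.2⟩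
  · intro c _
    exact secExp_liftExp hij hjk hik c
  · intro d hd
    exact liftExp_secExp hij hjk hik (Finset.mem_filter.mp hd).2.1
  · intro c _
    rw [coeff_res hij hjk hik, secExp_liftExp hij hjk hik]

omit hij hjk hik in
/-- The chart letter of the plane: `u_i ↦ X₀`, otherwise `X₁`.  DEFINITION (support). -/
def idx (i : Fin 3) (l : Fin 3) : Fin 2 := if l = i then 0 else 1

omit hij hjk hik in
/-- The plane components `(b_i, b_j)` of a translation vector.  DEFINITION (support). -/
def secPt (i j : Fin 3) (b : Fin 3 → K) : Fin 2 → K := fun m => if m = 0 then b i else b j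

/-- **The section commutes with a planar point transform (PROVED), both plane charts:** for the chart `u_l`,
`l ∈ {i, j}`, and a translation with `b_l = b_k = 0`,
`res (F(chart u_l, translated by b)) = (res F)(chart X_{idx l}, translated by (b_i, b_j))`. [folklore] -/
theorem res_pointTransform (q : ℕ) {l : Fin 3} (hl : l = i ∨ l = j) (b : Fin 3 → K) (hbl : b l = 0) (hbk : b k = 0)
    (F : MvPolynomial (Fin 3) K) (hF : ∀ d ∈ F.support, q ≤ d.degree) :
    res i j k (translate b (chartTransform q l F)) = translate (secPt i j b) (chartTransform q (idx i l) (res i j k F)) := by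
  classical
  have hG : ∀ c ∈ (res i j k F).support, q ≤ c.degree := fun c hc => le_degree_of_mem_support_res hij hjk hik hF hc
  ext c
  rw [coeff_res hij hjk hik]
  rcases hl with rfl | rfl
  · -- chart `u_i` ↦ `X₀`, translation along `u_j` ↦ `X₁`
    have h10 : (1 : Fin 2) ≠ 0 := by decide
    rw [show idx l l = 0 by simp [idx], coeff_pointTransform_planar hij.symm hik hjk q b hbl hbk F hF,
      coeff_pointTransform_two h10 q (secPt l j b) (by simp [secPt, hbl]) _ hG,
      sum_res_support hij hjk hik F (fun c' => c'.degree = c 0 + q)]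
    refine Finset.sum_congr ?_ fun d hd => ?_
    · refine Finset.filter_congr fun d _ => ?_
      rw [liftExp_k hjk hik, liftExp_i hij hik]
      constructor
      · rintro ⟨h1, h2⟩; exact ⟨h1, by rw [degree_secExp hij hjk hik h1]; exact h2⟩
      · rintro ⟨h1, h2⟩; exact ⟨h1, by rw [← degree_secExp hij hjk hik h1]; exact h2⟩
    · rw [secExp_one, liftExp_j hij hjk]
      simp [secPt]
  · -- chart `u_j` ↦ `X₁`, translation along `u_i` ↦ `X₀`
    have h01 : (0 : Fin 2) ≠ 1 := by decide
    rw [show idx i l = 1 by simp [idx, hij.symm], coeff_pointTransform_planar hij hjk hik q b hbl hbk F hF,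
      coeff_pointTransform_two h01 q (secPt i l b) (by simp [secPt, hbl]) _ hG,
      sum_res_support hij hjk hik F (fun c' => c'.degree = c 1 + q)]
    refine Finset.sum_congr ?_ fun d hd => ?_
    · refine Finset.filter_congr fun d _ => ?_
      rw [liftExp_k hjk hik, liftExp_j hij hjk]
      constructor
      · rintro ⟨h1, h2⟩; exact ⟨h1, by rw [degree_secExp hij hjk hik h1]; exact h2⟩
      · rintro ⟨h1, h2⟩; exact ⟨h1, by rw [← degree_secExp hij hjk hik h1]; exact h2⟩
    · rw [secExp_zero, liftExp_i hij hik]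
      simp [secPt]

/-- **The section commutes with cleaning (PROVED).** [folklore] -/
theorem res_deletePthPowers (q : ℕ) (P : MvPolynomial (Fin 3) K) :
    res i j k (deletePthPowers q P) = deletePthPowers q (res i j k P) := by
  classical
  ext c
  rw [coeff_res hij hjk hik, coeff_deletePthPowers, coeff_deletePthPowers, coeff_res hij hjk hik]
  by_cases h : IsPthPowerExponent q c
  · rw [if_pos h, if_pos ((isPthPowerExponent_liftExp hij hjk hik q c).mpr h)]
  · rw [if_neg h, if_neg (fun h' => h ((isPthPowerExponent_liftExp hij hjk hik q c).mp h'))]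

/-- The section does not lower the order. [folklore] -/
theorem le_ordZero_res (F : MvPolynomial (Fin 3) K) : ordZero F ≤ ordZero (res i j k F) := by
  rcases eq_or_ne (res i j k F) 0 with h0 | h0
  · rw [h0, ordZero_zero]; exact le_top
  obtain ⟨n, hn⟩ := exists_ordZero_eq_natCast h0
  obtain ⟨⟨c, hc, hdeg⟩, -⟩ := (ordZero_eq_nat_iff _ n).mp hn
  rw [hn, ← hdeg, ← degree_liftExp hij hjk hik]
  rw [coeff_res hij hjk hik] at hc
  exact Literature.Barriers.ResolutionOfSingularities.ordZero_le_of_coeff_ne_zero F _ hc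

/-- The section of a state with NON-EMPTY wall layer `0` is non-zero. [folklore] -/
theorem res_ne_zero_of_layer_zero {F : MvPolynomial (Fin 3) K} (h0 : ∃ d ∈ F.support, d k = 0) : res i j k F ≠ 0 := by
  obtain ⟨d, hd, hk⟩ := h0
  intro h
  have := secExp_mem_support_res hij hjk hik hd hk
  rw [h, MvPolynomial.support_zero] at this
  exact absurd this (Finset.notMem_empty _)

/-- **Equimultiplicity descends to the section (PROVED):** an equimultiple point of a planar move (chart `u_l`,
`l ∈ {i,j}`, `b_l = b_k = 0`) is an equimultiple point of the section's move. [folklore] -/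
theorem isEquimultiplePoint_res [DecidableEq K] (q : ℕ) {l : Fin 3} (hl : l = i ∨ l = j) (b : Fin 3 → K)
    (hbl : b l = 0) (hbk : b k = 0) (s : State (Fin 3) K) (hF : ∀ d ∈ s.F.support, q ≤ d.degree)
    (r₂ : Fin 2 →₀ ℕ) (heq : IsEquimultiplePoint q l b s) :
    IsEquimultiplePoint q (idx i l) (secPt i j b) ⟨res i j k s.F, r₂⟩ := by
  intro c hc0 hcq
  show coeff c (translate (secPt i j b) (chartTransform q (idx i l) (res i j k s.F))) = 0
  rw [← res_pointTransform hij hjk hik q hl b hbl hbk s.F hF, coeff_res hij hjk hik]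
  refine heq _ (fun h => hc0 ?_) (by rw [degree_liftExp hij hjk hik]; exact hcq)
  rw [← secExp_liftExp hij hjk hik c, h]
  ext m
  fin_cases m <;> simp [secExp]

end Section

section BaseChange

variable {K : Type} [Field K]

/-! ## §2 Base change to `K̄` and the section state -/

/-- Cleaning commutes with an injective change of coefficients. [folklore] -/
theorem map_deletePthPowers {σ : Type*} [DecidableEq σ] {L : Type*} [Field L] (f : K →+* L) (q : ℕ)
    (P : MvPolynomial σ K) : MvPolynomial.map f (deletePthPowers q P) = deletePthPowers q (MvPolynomial.map f P) := by
  ext c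
  rw [coeff_map, coeff_deletePthPowers, coeff_deletePthPowers, coeff_map]
  split_ifs <;> simp

end BaseChange

end Summit.ResolutionOfSingularities.ResolutionOfSingularities.Theorems.PlanarPort
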